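import Summits.ResolutionOfSingularities.ResolutionOfSingularities.Theorems.PurelyInseparableDim4Perm2BoundAttained
import HarnessLib

/-!
# [OURS · res-dim4-pi PR-2, part 7] After a maximal excess: MOH'S WITNESS, and NO SECOND EXCESS
  (the PERM2-0 analogue of «a kangaroo point is never followed by a kangaroo point», class `e = 1`)

Cell `res-dim4-pi` (D-0157 DOOR 2), lineage **PR-2** (seat `res-dim4-p-2`, generation 3), part 7 (sequel of
`…Perm2BoundAttained`, part 6a, p672725; notation as there). Class of record `q = p` (`e = 1`): a clean state
`(F, r, exc)` (`x^r ∣ F`, `o = ord₀ F`, shade `d = o − |r|`), a coordinate centre `V(z, x_S)` under condition (1)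
ONLY, chart `j ∈ S`, a point `b` over the origin of the centre, `g = ord_{(x_S)} F − Σ_S r_i`, and the new state
`s′ = (F′, r′, exc′)` with shade `d′`; part 3: `d′ + g ≤ 2d + 1`; part 6a: `d′ + g = 2d + 1 ⟺ TIGHT ∧ the point
blow-up at the same point is a kangaroo` (`Perm2Bound.shade_step_add_eq_two_mul_add_one_iff`).

## What is proved

§1 **`exists_witness_of_shade_step_add_eq_two_mul_add_one` — A MAXIMAL EXCESS CREATES MOH'S WITNESS.** If
`d′ + g = 2d + 1` then the new state `s′` has a LOST coordinate of the centre `x_{i₀}` (`i₀ ∈ S ∖ j`, `b_{i₀} ≠ 0`,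
`r_{i₀} ≥ 1`), now NON-exceptional (`r′_{i₀} = 0`), occurring in an INITIAL monomial of `F′` with an exponent prime
to `p`: Moh's «term `A`» / «`X`-kind variable» [Moh 1987, p. 972] of the kangaroo state `F′_pt`
(`PointBlowup.exists_nonexceptional_of_shadeIncreases`), pulled back through `φ : x_i ↦ x_j x_i (i ∉ S)` — which is
possible exactly because the edge is tight (initial monomials of `F′_pt` come from initial monomials of `F′`).
§2 **`shade_step_step_add_le_two_mul` — NO SECOND EXCESS.** After such an edge, for EVERY coordinate centre
`S′ ∋ j′` satisfying condition (1) for `F′` and EVERY point `b′` over the origin of `S′` (any chart, the witness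
variable's own chart included): `d″ + g′ ≤ 2d′` — the witness forbids any increase of the POINT blow-up of `s′`
(`PointBlowup.shade_step_le_of_witness`, Moh's cases (1)–(2)), and part 3's transfer does the rest;
`shade_step_step_add_ne_two_mul_add_one`: in particular NO TWO CONSECUTIVE MAXIMAL EXCESSES.
§3 **`shade_step_step_le_of_perm` — and NO RISE AT ALL if the next centre is Moh- (HP-) permissible** (condition (2)
for `s′`): the tree's `CentreBlowup.shade_step_le_of_witness` applied to the witness of §1.
§4 the same in the cell's letters (`PIDim4.State`, `IsPermissibleCentre`, `Perm2`, `RiseD`):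
`shade_add_ordAlong_le_two_mul_after_max` (no excess after a maximal excess) and
`not_riseD_after_max_of_perm2` (an HP-permissible edge after a maximal excess is not a RISE:d).

## What is NOT proved (honest scope)
`e = 1` only (at `q = p^e`, `e ≥ 2`, Moh's term `A` needs `q ∣ ord₀ F′_pt`, cf. the tree's
`PointBlowup.exists_initial_lowestLayer_of_pow_dvd`; not transferred here). A NON-maximal rise (`d < d′ ≤ 2d − g`,
the origin law of part 2) creates no witness and is not constrained by this file. Points moving ALONG the centre
are brick PR-1. [OURS · counted 0 · AI work weaker than expert review] NOTHING here proves resolution of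
singularities in dimension ≥ 4 / characteristic `p`: laws of the letter `d` of OUR candidate frame (MODE 1h
coordinate game); census value (the «+1 out of band» edges of crit-3 BANK-A3-01 are never consecutive and are
followed by a no-excess edge). bears_on: LADDER-RESOLUTION:D157-DOOR2 (res-dim4-pi · PR-2).
Supports stmt-ResolutionOfSingularities-16155 (helper).
-/

noncomputable section

set_option linter.dupNamespace false -- mandated namespace of this single-conjunct summit
open MvPolynomial Finset
open scoped BigOperators

namespace Summit.ResolutionOfSingularities.ResolutionOfSingularities.Theorems.PIDim4
namespace Perm2Bound
open Literature.AlgebraicGeometry.Resolution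
open Literature.AlgebraicGeometry.Resolution.CentreBlowup
open Literature.AlgebraicGeometry.Resolution.Hauser2010
open Literature.Barriers.ResolutionOfSingularities (ordZero_le_of_coeff_ne_zero le_ordZero_of_forall)

section Witness
variable {σ : Type*} {K : Type*} [Field K] [Fintype σ] [DecidableEq σ] [DecidableEq K]
variable (p : ℕ) [hp : Fact p.Prime] [CharP K p]

/-! ### §1 A maximal excess creates Moh's witness -/

/-- **A MAXIMAL EXCESS CREATES MOH'S WITNESS** (`q = p`, clean `F`, `x^r ∣ F`, condition (1), point `b` over
the origin of the centre, `d′ + g = 2d + 1`): some coordinate `x_{i₀}` of the centre, `i₀ ≠ j`, LOST at `b`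
(`b_{i₀} ≠ 0`) with `r_{i₀} ≠ 0`, is non-exceptional in the new state (`r′_{i₀} = 0`) and occurs in an initial
monomial `x^E` of `F′` (`|E| = ord₀ F′`) with `p ∤ E_{i₀}` — Moh's term `A` of the kangaroo state `F′_pt` pulled
back through the tight transfer. [cite: Moh1987, §1 (Statement (i)–(iii), p. 972)]
[cite: HauserPerlega2019PRIMS, §3 Comment (d)] -/
theorem exists_witness_of_shade_step_add_eq_two_mul_add_one {S : Finset σ} {j : σ} (hj : j ∈ S)
    (b : σ → K) (hbj : b j = 0) (hbN : ∀ i, i ∉ S → b i = 0) (s : CState σ K)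
    (hclean : deletePthPowers p s.F = s.F) {o : ℕ} (ho : ordZero s.F = o)
    (hr : ∀ d ∈ s.F.support, s.r ≤ d) (hq : ∀ d ∈ s.F.support, p ≤ degIn S d) {g : ℕ}
    (hg : ordAlong S s.F = ((degIn S s.r + g : ℕ) : ℕ∞))
    (heq : (step p S j b s).shade + (g : ℕ∞) = 2 * s.shade + 1) :
    ∃ i₀ ∈ S, i₀ ≠ j ∧ b i₀ ≠ 0 ∧ s.r i₀ ≠ 0 ∧ (step p S j b s).r i₀ = 0 ∧
      ∃ oG : ℕ, ordZero (step p S j b s).F = oG ∧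
        ∃ E ∈ (step p S j b s).F.support, E.degree = oG ∧ ¬ p ∣ E i₀ := by
  obtain ⟨⟨E₀, hE₀, hE₀deg, hE₀i⟩, hinc⟩ :=
    (shade_step_add_eq_two_mul_add_one_iff p hj b hbj hbN s hclean ho hr hq hg).mp heq
  have ht : (step p S j b s).F ≠ 0 := fun h => by
    rw [h, MvPolynomial.support_zero] at hE₀
    exact Finset.notMem_empty E₀ hE₀
  obtain ⟨oG, hoG⟩ := exists_ordZero_eq_natCast ht
  have hφ := lift_step_F p hj b hbj hbN s hq
  have hpt0 : (PointBlowup.step p j b s.toState).F ≠ 0 := by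
    rw [← hφ]; exact lift_ne_zero hj ht
  obtain ⟨o₁, ho₁⟩ := exists_ordZero_eq_natCast hpt0
  have hpo : p ≤ o := by
    obtain ⟨⟨d₀, hd₀, hd₀deg⟩, -⟩ := (ordZero_eq_nat_iff _ _).mp ho
    have k1 := hq d₀ (MvPolynomial.mem_support_iff.mpr hd₀)
    have k2 := degIn_le_degree S d₀
    omega
  -- Moh's term `A` of the kangaroo state `F′_pt`
  obtain ⟨i₀, hi₀, hbi₀, hri₀, hr1i₀, o₁', ho₁', -, E, hE, hEdeg, hEi₀, -⟩ :=
    PointBlowup.exists_nonexceptional_of_shadeIncreases p j b hbj s.toState hclean ho hpo hr hinc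
  have ho₁eq : o₁' = o₁ := by
    have h := ho₁'.symm.trans ho₁
    exact_mod_cast h
  subst ho₁eq
  -- tightness: `ord₀ F′_pt = ord₀ F′ + Σ_{i∉S} r_i`
  have hE₀deg' : E₀.degree = oG := by
    rw [hoG] at hE₀deg
    exact_mod_cast hE₀deg
  have ho₁G : o₁' = oG + (s.r.degree - degIn S s.r) :=
    (ordZero_pointStep_eq_add_iff hj b hbj hbN s ho hr hq hg hoG ho₁').mpr ⟨E₀, hE₀, hE₀deg', hE₀i⟩
  -- off `S` every monomial of `F′` dominates `r` (for the pull-back of an initial monomial)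
  obtain ⟨-, hN⟩ := degree_step_r_transfer b hbj s ho hr hq hg
  have hr1 := step_r_le_of_mem_support_step p S j b hbj s hr
  have h2 := degIn_add_sum_compl S s.r
  have hrN : ∀ e ∈ (step p S j b s).F.support, s.r.degree - degIn S s.r ≤ e.degree - degIn S e := by
    intro e he
    have h1 := degIn_add_sum_compl S e
    have h3 : ∑ i ∈ Sᶜ, s.r i ≤ ∑ i ∈ Sᶜ, e i := Finset.sum_le_sum fun i hi => by
      have hi' : i ∉ S := Finset.mem_compl.mp hi
      have hij : i ≠ j := fun h => hi' (h ▸ hj)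
      rw [← hN i hij (hbN i hi')]
      exact Finsupp.le_def.mp (hr1 e he) i
    omega
  -- pull `x^E` back through `φ`
  have hEs : E ∈ (PointBlowup.step p j b s.toState).F.support := hE
  rw [← hφ] at hEs
  obtain ⟨e, he, hψ⟩ := exists_of_mem_support_lift S j _ hEs
  have hdeg : (e + Finsupp.single j (e.degree - degIn S e)).degree = oG + (s.r.degree - degIn S s.r) := by
    rw [hψ, hEdeg, ho₁G]
  obtain ⟨hedeg, -⟩ := degree_eq_of_lift_initial S j _ hoG hrN he hdeg
  have hei₀ : e i₀ = E i₀ := by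
    rw [← hψ, lift_apply, if_neg hi₀]
  have hi₀S : i₀ ∈ S := by
    by_contra h
    exact hbi₀ (hbN i₀ h)
  refine ⟨i₀, hi₀S, hi₀, hbi₀, hri₀, ?_, oG, hoG, e, he, hedeg, by rw [hei₀]; exact hEi₀⟩
  rw [step_r_apply_of_ne p S hi₀ b s]
  exact hr1i₀

/-! ### §2 No second excess -/

/-- **NO SECOND EXCESS** (`q = p`): after an edge with `d′ + g = 2d + 1` (hypotheses of §1), for EVERY
coordinate centre `S′ ∋ j′` satisfying condition (1) for the new state `s′` and EVERY point `b′` over the origin of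
`S′` — any chart, the witness variable's own chart included — the next edge has no excess over ITS origin bound:
`d″ + g′ ≤ 2d′` (`g′ = ord_{(x_{S′})} F′ − Σ_{S′} r′_i`). Moh's witness forbids any increase of the point blow-up of
`s′` (`PointBlowup.shade_step_le_of_witness`), and the transfer `d″ + g′ ≤ d″_pt + d′` concludes. The PERM2-0
analogue of «no two consecutive kangaroo points» (`PointBlowup.not_shadeIncreases_step_of_shadeIncreases`).
[cite: Moh1987, §1 (p. 972, cases (1)–(2))] [cite: Hauser2010, §G (a kangaroo point is not followed by one)] -/
theorem shade_step_step_add_le_two_mul {S : Finset σ} {j : σ} (hj : j ∈ S) (b : σ → K) (hbj : b j = 0)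
    (hbN : ∀ i, i ∉ S → b i = 0) (s : CState σ K) (hclean : deletePthPowers p s.F = s.F) {o : ℕ}
    (ho : ordZero s.F = o) (hr : ∀ d ∈ s.F.support, s.r ≤ d)
    (hq : ∀ d ∈ s.F.support, p ≤ degIn S d) {g : ℕ}
    (hg : ordAlong S s.F = ((degIn S s.r + g : ℕ) : ℕ∞))
    (heq : (step p S j b s).shade + (g : ℕ∞) = 2 * s.shade + 1)
    {S' : Finset σ} {j' : σ} (hj' : j' ∈ S') (b' : σ → K) (hbj' : b' j' = 0)
    (hbN' : ∀ i, i ∉ S' → b' i = 0)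
    (hq' : ∀ d ∈ (step p S j b s).F.support, p ≤ degIn S' d) {g' : ℕ}
    (hg' : ordAlong S' (step p S j b s).F = ((degIn S' (step p S j b s).r + g' : ℕ) : ℕ∞)) :
    (step p S' j' b' (step p S j b s)).shade + (g' : ℕ∞) ≤ 2 * (step p S j b s).shade := by
  obtain ⟨i₀, -, -, -, -, hr1i₀, oG, hoG, E, hE, hEdeg, hEi₀⟩ :=
    exists_witness_of_shade_step_add_eq_two_mul_add_one p hj b hbj hbN s hclean ho hr hq hg heq
  have hr1 := step_r_le_of_mem_support_step p S j b hbj s hr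
  have hpo' : p ≤ oG := by
    have k1 := hq' E hE
    have k2 := degIn_le_degree S' E
    omega
  have hT := shade_step_add_le_shade_pointStep_add hj' b' hbj' hbN' (step p S j b s) hoG hr1 hq' hg'
  have hW := PointBlowup.shade_step_le_of_witness p j' b' hbj' (step p S j b s).toState hoG hpo' hr1
    hr1i₀ hE hEdeg hEi₀
  have hs : (step p S j b s).toState.shade = (step p S j b s).shade := rfl
  rw [hs] at hW
  calc (step p S' j' b' (step p S j b s)).shade + (g' : ℕ∞)
      ≤ (PointBlowup.step p j' b' (step p S j b s).toState).shade + (step p S j b s).shade := hT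
    _ ≤ (step p S j b s).shade + (step p S j b s).shade := add_le_add hW le_rfl
    _ = 2 * (step p S j b s).shade := (two_mul _).symm

/-- **NO TWO CONSECUTIVE MAXIMAL EXCESSES** (`q = p`): after `d′ + g = 2d + 1` the next edge over the origin
of any condition-(1) centre never has `d″ + g′ = 2d′ + 1`. [cite: Hauser2010, §G (a kangaroo point is not followed by one)] -/
theorem shade_step_step_add_ne_two_mul_add_one {S : Finset σ} {j : σ} (hj : j ∈ S) (b : σ → K)
    (hbj : b j = 0) (hbN : ∀ i, i ∉ S → b i = 0) (s : CState σ K)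
    (hclean : deletePthPowers p s.F = s.F) {o : ℕ} (ho : ordZero s.F = o)
    (hr : ∀ d ∈ s.F.support, s.r ≤ d) (hq : ∀ d ∈ s.F.support, p ≤ degIn S d) {g : ℕ}
    (hg : ordAlong S s.F = ((degIn S s.r + g : ℕ) : ℕ∞))
    (heq : (step p S j b s).shade + (g : ℕ∞) = 2 * s.shade + 1)
    {S' : Finset σ} {j' : σ} (hj' : j' ∈ S') (b' : σ → K) (hbj' : b' j' = 0)
    (hbN' : ∀ i, i ∉ S' → b' i = 0)
    (hq' : ∀ d ∈ (step p S j b s).F.support, p ≤ degIn S' d) {g' : ℕ}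
    (hg' : ordAlong S' (step p S j b s).F = ((degIn S' (step p S j b s).r + g' : ℕ) : ℕ∞)) :
    (step p S' j' b' (step p S j b s)).shade + (g' : ℕ∞) ≠ 2 * (step p S j b s).shade + 1 := by
  have hle := shade_step_step_add_le_two_mul p hj b hbj hbN s hclean ho hr hq hg heq hj' b' hbj' hbN' hq' hg'
  obtain ⟨-, -, -, -, -, -, oG, hoG, -⟩ :=
    exists_witness_of_shade_step_add_eq_two_mul_add_one p hj b hbj hbN s hclean ho hr hq hg heq
  have hfin : 2 * (step p S j b s).shade ≠ ⊤ := by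
    rw [CState.shade_eq_of_ordZero_eq _ hoG, two_mul, ← Nat.cast_add]
    exact ENat.coe_ne_top _
  intro h
  rw [h] at hle
  exact absurd ((ENat.lt_add_one_iff hfin).mpr le_rfl) (not_lt.mpr hle)

/-! ### §3 No rise at all under a Moh-permissible next centre -/

/-- **After a maximal excess, a Moh- (HP-) permissible next step never raises the shade** (`q = p`): if the next
coordinate centre `S′ ∋ j′` satisfies conditions (1) AND (2) for `s′` (every monomial `x^e` of `F′` has
`degIn S′ e ≥ Σ_{S′} r′_i + d′`), then at every point `b′` over the origin of `S′`, `d″ ≤ d′` — the tree's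
`CentreBlowup.shade_step_le_of_witness` on the witness of §1. [cite: Moh1987, §1 (p. 972)]
[cite: HauserPerlega2019PRIMS, §3 Theorem (7) and Comment (d)] -/
theorem shade_step_step_le_of_perm {S : Finset σ} {j : σ} (hj : j ∈ S) (b : σ → K) (hbj : b j = 0)
    (hbN : ∀ i, i ∉ S → b i = 0) (s : CState σ K) (hclean : deletePthPowers p s.F = s.F) {o : ℕ}
    (ho : ordZero s.F = o) (hr : ∀ d ∈ s.F.support, s.r ≤ d)
    (hq : ∀ d ∈ s.F.support, p ≤ degIn S d) {g : ℕ}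
    (hg : ordAlong S s.F = ((degIn S s.r + g : ℕ) : ℕ∞))
    (heq : (step p S j b s).shade + (g : ℕ∞) = 2 * s.shade + 1)
    {S' : Finset σ} {j' : σ} (hj' : j' ∈ S') (b' : σ → K) (hbj' : b' j' = 0)
    (hbN' : ∀ i, i ∉ S' → b' i = 0)
    (hq' : ∀ d ∈ (step p S j b s).F.support, p ≤ degIn S' d) {oG : ℕ}
    (hoG : ordZero (step p S j b s).F = oG)
    (hperm' : ∀ d ∈ (step p S j b s).F.support,
      degIn S' (step p S j b s).r + (oG - (step p S j b s).r.degree) ≤ degIn S' d) :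
    (step p S' j' b' (step p S j b s)).shade ≤ (step p S j b s).shade := by
  obtain ⟨i₀, -, -, -, -, hr1i₀, oG', hoG', E, hE, hEdeg, hEi₀⟩ :=
    exists_witness_of_shade_step_add_eq_two_mul_add_one p hj b hbj hbN s hclean ho hr hq hg heq
  have hoGeq : oG' = oG := by
    have h := hoG'.symm.trans hoG
    exact_mod_cast h
  subst hoGeq
  have hr1 := step_r_le_of_mem_support_step p S j b hbj s hr
  exact CentreBlowup.shade_step_le_of_witness p hj' b' hbj' hbN' (step p S j b s) hoG' hr1 hq' hperm'
    hr1i₀ hE hEdeg hEi₀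

end Witness
end Perm2Bound

/-! ### §4 In the cell's vocabulary (class (4,1), `q = p`) -/

section Cell
open Literature.AlgebraicGeometry.Resolution
open Literature.AlgebraicGeometry.Resolution.CentreBlowup
open Literature.AlgebraicGeometry.Resolution.Hauser2010
variable {K : Type} [Field K] [DecidableEq K] (p : ℕ) [Fact p.Prime] [CharP K p]

/-- From the cell's «maximal excess» equation `d′ + ordAlong S F = 2d + degIn S r + 1` to the internal form
`d′ + g = 2d + 1` (`ordAlong S F = degIn S r + g`). [folklore] -/
theorem Perm2Bound.shade_step_add_eq_of_cell {q : ℕ} {S : Finset (Fin 4)} {j : Fin 4} {b : Fin 4 → K}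
    {s : State K} {g : ℕ} (hg : ordAlong S s.F = ((degIn S s.r + g : ℕ) : ℕ∞))
    (hmax : (CentreBlowup.step q S j b s).shade + ordAlong S s.F = 2 * s.shade + degIn S s.r + 1) :
    (CentreBlowup.step q S j b s).shade + (g : ℕ∞) = 2 * s.shade + 1 := by
  have e1 : (CentreBlowup.step q S j b s).shade + ordAlong S s.F =
      ((CentreBlowup.step q S j b s).shade + (g : ℕ∞)) + (degIn S s.r : ℕ∞) := by
    rw [hg, Nat.cast_add]; ring
  have e2 : 2 * s.shade + (degIn S s.r : ℕ∞) + 1 = (2 * s.shade + 1) + (degIn S s.r : ℕ∞) := by ring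
  rw [e1, e2] at hmax
  exact (ENat.add_left_injective_of_ne_top (ENat.coe_ne_top (degIn S s.r))) hmax

/-- **NO EXCESS AFTER A MAXIMAL EXCESS, in the cell's letters** (class (4,1), `q = p`): if the edge of a
Hironaka-permissible centre `S ∋ j` to a point `b` over its origin has `d′ + ordAlong S F = 2d + degIn S r + 1`,
then for every Hironaka-permissible centre `S′ ∋ j′` of the new state `s′` and every point `b′` over its origin,
`d″ + ordAlong S′ F′ ≤ 2d′ + degIn S′ r′`. [OURS · about the candidate frame] [cite: Moh1987, §1 (p. 972)] -/
theorem shade_add_ordAlong_le_two_mul_after_max {S : Finset (Fin 4)} {j : Fin 4} (hj : j ∈ S)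
    (b : Fin 4 → K) (hbj : b j = 0) (hbN : ∀ i, i ∉ S → b i = 0) (s : State K)
    (hclean : deletePthPowers p s.F = s.F) (hr : ∀ d ∈ s.F.support, s.r ≤ d)
    (hS : IsPermissibleCentre p S s.F)
    (hmax : (CentreBlowup.step p S j b s).shade + ordAlong S s.F = 2 * s.shade + degIn S s.r + 1)
    {S' : Finset (Fin 4)} {j' : Fin 4} (hj' : j' ∈ S') (b' : Fin 4 → K) (hbj' : b' j' = 0)
    (hbN' : ∀ i, i ∉ S' → b' i = 0) (hS' : IsPermissibleCentre p S' (CentreBlowup.step p S j b s).F) :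
    (CentreBlowup.step p S' j' b' (CentreBlowup.step p S j b s)).shade +
        ordAlong S' (CentreBlowup.step p S j b s).F ≤
      2 * (CentreBlowup.step p S j b s).shade + degIn S' (CentreBlowup.step p S j b s).r := by
  by_cases hF' : (CentreBlowup.step p S j b s).F = 0
  · -- degenerate: `F′ = 0` makes the right side `⊤`
    have hsh : (CentreBlowup.step p S j b s).shade = ⊤ := by
      unfold CState.shade; rw [hF', ordZero_zero, ENat.top_sub_coe]
    rw [hsh, two_mul, top_add, top_add]
    exact le_top
  have hF : s.F ≠ 0 := by
    intro h
    apply hF'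
    show deletePthPowers p (pointTransform p S j b s) = 0
    rw [pointTransform_eq_sum, h, MvPolynomial.support_zero, Finset.sum_empty, deletePthPowers_zero]
  obtain ⟨o, ho⟩ := exists_ordZero_eq_natCast hF
  obtain ⟨g, hg⟩ := exists_ordAlong_eq_add S s hF hr
  have hq := forall_le_degIn_of_isPermissibleCentre hS
  have heq := Perm2Bound.shade_step_add_eq_of_cell hg hmax
  have hr1 := Perm2Bound.step_r_le_of_mem_support_step p S j b hbj s hr
  obtain ⟨g', hg'⟩ := exists_ordAlong_eq_add S' (CentreBlowup.step p S j b s) hF' hr1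
  have hq' := forall_le_degIn_of_isPermissibleCentre hS'
  have h := Perm2Bound.shade_step_step_add_le_two_mul p hj b hbj hbN s hclean ho hr hq hg heq hj' b' hbj'
    hbN' hq' hg'
  have e1 : (CentreBlowup.step p S' j' b' (CentreBlowup.step p S j b s)).shade +
      ordAlong S' (CentreBlowup.step p S j b s).F =
      ((CentreBlowup.step p S' j' b' (CentreBlowup.step p S j b s)).shade + (g' : ℕ∞)) +
        (degIn S' (CentreBlowup.step p S j b s).r : ℕ∞) := by
    rw [hg', Nat.cast_add]; ring
  rw [e1]
  exact add_le_add h le_rfl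

/-- **An HP-permissible edge after a maximal excess is NOT a RISE:d, in the cell's letters** (class (4,1),
`q = p`): if the edge of a Hironaka-permissible centre `S ∋ j` to a point `b` over its origin has the maximal
excess `d′ + ordAlong S F = 2d + degIn S r + 1`, then for every centre `S′ ∋ j′` with
`IsPermissibleCentre p S′ F′ ∧ Perm2 S′ s′` and every point `b′` over its origin, `¬ RiseD s′ s″`.
[OURS · about the candidate frame] [cite: Moh1987, §1 (p. 972)] [cite: HauserPerlega2019PRIMS, §3 Comment (d)] -/
theorem not_riseD_after_max_of_perm2 {S : Finset (Fin 4)} {j : Fin 4} (hj : j ∈ S)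
    (b : Fin 4 → K) (hbj : b j = 0) (hbN : ∀ i, i ∉ S → b i = 0) (s : State K)
    (hclean : deletePthPowers p s.F = s.F) (hr : ∀ d ∈ s.F.support, s.r ≤ d)
    (hS : IsPermissibleCentre p S s.F)
    (hmax : (CentreBlowup.step p S j b s).shade + ordAlong S s.F = 2 * s.shade + degIn S s.r + 1)
    {S' : Finset (Fin 4)} {j' : Fin 4} (hj' : j' ∈ S') (b' : Fin 4 → K) (hbj' : b' j' = 0)
    (hbN' : ∀ i, i ∉ S' → b' i = 0) (hS' : IsPermissibleCentre p S' (CentreBlowup.step p S j b s).F)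
    (h2' : Perm2 S' (CentreBlowup.step p S j b s)) :
    ¬ RiseD (CentreBlowup.step p S j b s) (CentreBlowup.step p S' j' b' (CentreBlowup.step p S j b s)) := by
  unfold RiseD
  rw [not_lt]
  by_cases hF' : (CentreBlowup.step p S j b s).F = 0
  · have hsh : (CentreBlowup.step p S j b s).shade = ⊤ := by
      unfold CState.shade; rw [hF', ordZero_zero, ENat.top_sub_coe]
    rw [hsh]; exact le_top
  have hF : s.F ≠ 0 := by
    intro h
    apply hF'
    show deletePthPowers p (pointTransform p S j b s) = 0
    rw [pointTransform_eq_sum, h, MvPolynomial.support_zero, Finset.sum_empty, deletePthPowers_zero]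
  obtain ⟨o, ho⟩ := exists_ordZero_eq_natCast hF
  obtain ⟨g, hg⟩ := exists_ordAlong_eq_add S s hF hr
  have hq := forall_le_degIn_of_isPermissibleCentre hS
  have heq := Perm2Bound.shade_step_add_eq_of_cell hg hmax
  obtain ⟨oG, hoG⟩ := exists_ordZero_eq_natCast hF'
  have hq' := forall_le_degIn_of_isPermissibleCentre hS'
  exact Perm2Bound.shade_step_step_le_of_perm p hj b hbj hbN s hclean ho hr hq hg heq hj' b' hbj' hbN' hq'
    hoG ((perm2_iff_forall S' _ hoG).mp h2')

end Cell

end Summit.ResolutionOfSingularities.ResolutionOfSingularities.Theorems.PIDim4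

end
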